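import Literature.Probability.RandomPlanarGeometry.SLETraceContinuity
import Literature.Probability.RandomPlanarGeometry.LocalMartingaleProofs
import HarnessLib

/-!
# The SLE trace for every Brownian driving process; the shifted driving function

Trunk T-STOCH. `SLETraceContinuity.lean` proves Rohde–Schramm's Thm. 3.6 (*Basic properties of
SLE*, Ann. of Math. 161 (2005)) on the canonical space from the one-point derivative estimate
Cor. 3.5 (the named fact `RohdeSchramm2005_cor35 P`, stated for *every* Brownian motion with
continuous paths on the probability space `(Ω, P)`), and hence the trace theorem Thm. 5.1
(`hasSLETrace_of_ne_eight_of_cor35`) for the canonical driving function `√κ B`.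

The same printed proof applies verbatim to **any** Brownian motion `B` on `(Ω, P)` with
everywhere-continuous paths, and this file records that generality, which is what the
*conformal Markov property of the SLE trace* needs: the increment process
`u ↦ B(s + u) - B(s)` is again such a Brownian motion (Mathlib `IsBrownianReal.shift`), but the
almost sure statement `HasSLETrace κ` about the canonical `B` cannot be transported to it by a
law argument (the event "the chain is generated by a curve" is not known to be measurable).

* `ae_exists_continuous_tipApproach_of_cor35` — Thm. 3.6 for every `IsBrownianReal B P` with
  continuous paths (`κ ≠ 0, 8`): a.s. `H(y, t) = fₜ(√κ Bₜ + iy)` extends continuously to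
  `[0, ∞) × [0, ∞)` (the proof of `RohdeSchramm2005_thm36_of_cor35`, with `B` for the canonical
  process);
* `ae_exists_isGeneratedByCurve_of_cor35` — hence (Thm. 4.1, proved: `RohdeSchramm2005_thm41_holds`)
  a.s. the Loewner chain of `√κ B(ω)` is generated by a curve;
* `ae_exists_isGeneratedByCurve_shift_of_cor35` — on the canonical space, for every `s ≥ 0`, a.s.
  the chain of the increments `u ↦ W(s + u) - W(s)` of the SLE_κ driving function is generated by
  a curve (Rohde–Schramm (2005), Thm. 5.1 applied to the shifted Brownian motion; the input of the
  Markov property "`gₛ(γ[s, ∞)) - ξ(s)` has the same distribution as `γ`" used in §7, p. 911).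

## References

* S. Rohde, O. Schramm, *Basic properties of SLE*, Ann. of Math. 161 (2005): Cor. 3.5, Thm. 3.6
  and its proof (pp. 895–898), Thm. 4.1, Thm. 5.1; §7 p. 911 (Markov property of the trace).
* G. F. Lawler, *Conformally Invariant Processes in the Plane*, AMS (2005), §6.2 (the curves
  `γˢ(t) = gₛ(γ(t + s)) - √κ Bₛ` "have the same distribution as `γ`"), Lemma 4.33.
-/

noncomputable section

open Set Filter Topology MeasureTheory ProbabilityTheory Complex
open UpperHalfPlane (upperHalfPlaneSet isOpen_upperHalfPlaneSet)
open scoped NNReal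

namespace Literature.Probability.RandomPlanarGeometry

section General

variable {Ω : Type*} [MeasurableSpace Ω] {P : Measure Ω} {B : ℝ≥0 → Ω → ℝ} {κ : ℝ≥0}

/-- **Rohde–Schramm's Thm. 3.6 for every Brownian driving process.** Let `B` be a Brownian motion
on `(Ω, P)` with everywhere-continuous paths and let Cor. 3.5 hold on `(Ω, P)`
(`RohdeSchramm2005_cor35 P`). For `κ ≠ 0, 8`, almost surely `H(y, t) = fₜ(√κ Bₜ + iy)` extends
continuously to `[0, ∞) × [0, ∞)`. The proof is that of `RohdeSchramm2005_thm36_of_cor35`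
(Borel–Cantelli on the dyadic grid, Lévy's modulus, Lawler's Lemma 4.33, scale invariance through
the rescaled Brownian motions `2^{-n} B(4ⁿ ·)`), written for `B` in place of the canonical
process. [cite: RohdeSchramm2005, Thm 3.6] -/
theorem ae_exists_continuous_tipApproach_of_cor35 (h : RohdeSchramm2005_cor35 P)
    (hB : IsBrownianReal B P) (hBc : ∀ ω, Continuous (B · ω)) (hκ : κ ≠ 0) (h8 : κ ≠ 8) :
    ∀ᵐ ω ∂P, ∃ H : ℝ≥0 × ℝ≥0 → ℂ, Continuous H ∧ ∀ (y t : ℝ≥0), y ≠ 0 →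
      H (y, t) = Loewner.tipApproach (fun s ↦ Real.sqrt κ * B s ω) (y, t) := by
  have hκpos : (0 : ℝ) < κ := by exact_mod_cast pos_iff_ne_zero.2 hκ
  set σ : ℝ := RohdeSchramm.sigma0 κ / 2 with hσ
  have hσpos : 0 < RohdeSchramm.sigma0 κ := RohdeSchramm.sigma0_pos hκpos (by exact_mod_cast h8)
  have hσ0 : 0 < σ := by positivity
  have hσ1 : σ < RohdeSchramm.sigma0 κ := by rw [hσ]; linarith
  -- the rescaled Brownian motions `Bₙ(t) = 2^{-n} B(4ⁿ t)` and their driving functions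
  set Bs : ℕ → ℝ≥0 → Ω → ℝ := fun n t ω ↦
    (√((((2 : ℝ≥0) ^ n) ^ 2 : ℝ≥0) : ℝ))⁻¹ * B (((2 : ℝ≥0) ^ n) ^ 2 * t) ω with hBs
  have hBn : ∀ n, IsBrownianReal (Bs n) P := fun n ↦
    hB.smul (pow_ne_zero 2 (pow_ne_zero n two_ne_zero))
  have hBsc : ∀ n ω, Continuous fun t ↦ Bs n t ω := fun n ω ↦
    continuous_const.mul ((hBc ω).comp (continuous_const.mul continuous_id))
  have hsq : ∀ n : ℕ, √((((2 : ℝ≥0) ^ n) ^ 2 : ℝ≥0) : ℝ) = ((2 ^ n : ℝ≥0) : ℝ) := fun n ↦ by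
    push_cast
    exact Real.sqrt_sq (by positivity)
  -- almost surely: grid bounds and modulus at every scale
  have hgrid : ∀ n, ∀ᵐ ω ∂P, ∃ c : ℝ, ∀ j k : ℕ, k < 4 ^ j →
      ‖deriv (Loewner.fHat (fun s ↦ Real.sqrt κ * Bs n s ω) ((k : ℝ≥0) / 4 ^ j))
        (I * ((2 : ℝ) ^ (-(j : ℝ)) : ℝ))‖ ≤ c * (2 : ℝ) ^ ((1 - σ) * j) :=
    fun n ↦ h.ae_exists_grid hκ h8 hσ0 hσ1 (hBn n) (hBsc n)
  have hmod : ∀ n, ∀ᵐ ω ∂P, ∃ c : ℝ, ∀ j : ℕ, 1 ≤ j → ∀ s t : ℝ≥0,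
      s ≤ (2 : ℕ) → t ≤ (2 : ℕ) → dist s t ≤ (4 ^ j)⁻¹ →
      |Bs n s ω - Bs n t ω| ≤ c * Real.sqrt j / 2 ^ j := fun n ↦ by
    filter_upwards [(hBn n).ae_forall_exists_abs_sub_le_sqrt] with ω hω using hω 2
  rw [← ae_all_iff] at hgrid hmod
  filter_upwards [hgrid, hmod] with ω hg hm
  -- deterministic part, for the fixed path `ω`
  set W : ℝ≥0 → ℝ := fun s ↦ Real.sqrt κ * B s ω with hW_def
  have hW : Continuous W := continuous_const.mul (hBc ω)
  set V : ℕ → ℝ≥0 → ℝ := fun n s ↦ Real.sqrt κ * Bs n s ω with hV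
  have hVc : ∀ n, Continuous (V n) := fun n ↦ continuous_const.mul (hBsc n ω)
  have hWV : ∀ n (s : ℝ≥0), W s = ((2 ^ n : ℝ≥0) : ℝ) * V n (s / (2 ^ n) ^ 2) := by
    intro n s
    have hc : ((2 : ℝ≥0) ^ n) ^ 2 ≠ 0 := pow_ne_zero 2 (pow_ne_zero n two_ne_zero)
    rw [hW_def, hV, hBs]
    simp only
    rw [hsq n, mul_div_cancel₀ _ hc]
    have h2 : ((2 ^ n : ℝ≥0) : ℝ) ≠ 0 := by positivity
    field_simp
  obtain ⟨hc, heq⟩ := Loewner.continuous_extendFrom_tipApproach_of_scales hW V hVc hWV fun n ↦ by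
    obtain ⟨c₁, hc₁⟩ := hg n
    obtain ⟨c₂, hc₂⟩ := hm n
    refine Loewner.continuousOn_extendFrom_tipApproach (hVc n) hσ0 hc₁ (c₂ := Real.sqrt κ * c₂) ?_
    intro j hj s t hs ht hd
    have h1 := hc₂ j hj s t (by simpa using hs) (by simpa using ht) hd
    rw [hV]
    simp only
    rw [← mul_sub, abs_mul, abs_of_nonneg (Real.sqrt_nonneg _), mul_assoc, mul_div_assoc]
    exact mul_le_mul_of_nonneg_left h1 (Real.sqrt_nonneg _)
  exact ⟨_, hc, fun y t hy ↦ heq (y, t) hy⟩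

/-- **The Loewner chain of `√κ B` is a.s. generated by a curve, for every Brownian driving
process** (`B` a Brownian motion on `(Ω, P)` with everywhere-continuous paths, Cor. 3.5 on
`(Ω, P)`, `κ ≠ 0, 8`): Rohde–Schramm's Thm. 5.1 in law-invariant form, by Thm. 3.6
(`ae_exists_continuous_tipApproach_of_cor35`) and the proved deterministic criterion Thm. 4.1
(`RohdeSchramm2005_thm41_holds`), as in the printed proof (p. 899). [cite: RohdeSchramm2005, Thm 5.1] -/
theorem ae_exists_isGeneratedByCurve_of_cor35 (h : RohdeSchramm2005_cor35 P)
    (hB : IsBrownianReal B P) (hBc : ∀ ω, Continuous (B · ω)) (hκ : κ ≠ 0) (h8 : κ ≠ 8) :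
    ∀ᵐ ω ∂P, ∃ γ, Loewner.IsGeneratedByCurve (fun s ↦ Real.sqrt κ * B s ω) γ := by
  filter_upwards [ae_exists_continuous_tipApproach_of_cor35 h hB hBc hκ h8] with ω ⟨H, hHc, hH⟩
  set ξ : ℝ≥0 → ℝ := fun s ↦ Real.sqrt κ * B s ω with hξ
  have hξc : Continuous ξ := continuous_const.mul (hBc ω)
  set β : ℝ≥0 → ℂ := fun t ↦ H (0, t) with hβ
  refine ⟨β, Loewner.isGeneratedByCurve_of_thm41 RohdeSchramm2005_thm41_holds hξc
    (hHc.comp (Continuous.prodMk continuous_const continuous_id)) fun t ↦ ?_⟩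
  -- the limit along `y ↓ 0` is the value of the continuous extension at `(0, t)`
  have hpath : Tendsto (fun y : ℝ ↦ ((y.toNNReal, t) : ℝ≥0 × ℝ≥0)) (𝓝[>] 0) (𝓝 (0, t)) := by
    have : Tendsto (fun y : ℝ ↦ ((y.toNNReal, t) : ℝ≥0 × ℝ≥0)) (𝓝 0) (𝓝 ((0 : ℝ).toNNReal, t)) :=
      ((continuous_real_toNNReal.prodMk continuous_const).tendsto 0)
    simpa using this.mono_left nhdsWithin_le_nhds
  refine ((hHc.continuousAt.tendsto).comp hpath).congr' ?_
  filter_upwards [self_mem_nhdsWithin] with y hy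
  have hy' : (y.toNNReal : ℝ≥0) ≠ 0 := by
    simpa using hy
  rw [Function.comp_apply, hH _ _ hy', Loewner.tipApproach_apply, Real.coe_toNNReal _ (le_of_lt hy)]

end General

/-! ### The canonical space: shifted driving functions -/

section Canonical

variable {κ : ℝ≥0}

/-- **The chain of the increments of the SLE_κ driving function after time `s` is a.s. generated
by a curve** (`κ ≠ 0, 8`, given Cor. 3.5 on the canonical space): `u ↦ W(s + u) - W(s) =
√κ (B(s + u) - B(s))` is `√κ` times a Brownian motion with continuous paths (Mathlib
`IsBrownianReal.shift`), to which `ae_exists_isGeneratedByCurve_of_cor35` applies. This is the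
existence half of the Markov property of the SLE trace at the fixed time `s` (Rohde–Schramm
(2005), §7 p. 911; Lawler (2005), §6.2, the curves `γˢ`). [cite: RohdeSchramm2005, Thm 5.1] -/
theorem ae_exists_isGeneratedByCurve_shift_of_cor35
    (h : RohdeSchramm2005_cor35 Process.preWienerMeasure) (hκ : κ ≠ 0) (h8 : κ ≠ 8) (s : ℝ≥0) :
    ∀ᵐ ω ∂Process.preWienerMeasure,
      ∃ γ, Loewner.IsGeneratedByCurve (fun u ↦ sleDriving κ ω (s + u) - sleDriving κ ω s) γ := by
  have hB : IsBrownianReal (fun t ω ↦ Process.brownian (s + t) ω - Process.brownian s ω)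
      Process.preWienerMeasure := isBrownianReal_brownian'.shift s
  have hBc : ∀ ω, Continuous fun t ↦ Process.brownian (s + t) ω - Process.brownian s ω := fun ω ↦
    ((Process.continuous_brownian ω).comp (continuous_const.add continuous_id)).sub continuous_const
  filter_upwards [ae_exists_isGeneratedByCurve_of_cor35 h hB hBc hκ h8] with ω hω
  have hfun : (fun u ↦ sleDriving κ ω (s + u) - sleDriving κ ω s) =
      fun u ↦ Real.sqrt κ * (Process.brownian (s + u) ω - Process.brownian s ω) :=
    funext fun u ↦ by simp only [sleDriving, mul_sub]
  rwa [hfun]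

/-- The same for the whole family of shifts at once along any countable set of times, e.g. the
rationals: a.s., for every `s` in the set, the chain of `u ↦ W(s + u) - W(s)` is generated by a
curve. [cite: RohdeSchramm2005, Thm 5.1] -/
theorem ae_forall_exists_isGeneratedByCurve_shift_of_cor35
    (h : RohdeSchramm2005_cor35 Process.preWienerMeasure) (hκ : κ ≠ 0) (h8 : κ ≠ 8)
    {S : Set ℝ≥0} (hS : S.Countable) :
    ∀ᵐ ω ∂Process.preWienerMeasure, ∀ s ∈ S,
      ∃ γ, Loewner.IsGeneratedByCurve (fun u ↦ sleDriving κ ω (s + u) - sleDriving κ ω s) γ := by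
  rw [ae_ball_iff hS]
  exact fun s _ ↦ ae_exists_isGeneratedByCurve_shift_of_cor35 h hκ h8 s

end Canonical

end Literature.Probability.RandomPlanarGeometry
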